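import Literature.AlgebraicGeometry.Resolution.DerivationCompletion
import Mathlib.RingTheory.Localization.AtPrime.Basic
import Mathlib.RingTheory.Spectrum.Prime.Topology
import HarnessLib

/-!
# Giraud's critical locus `E(f)` in coordinates, where the absolute differentials are free

Route `ResolutionOfSingularities/RadicialJung`, crux `CleanModels` (stmt-ResolutionOfSingularities-15917),
line `via-clean-models` of crux `DescentPerfectToAll` (stmt-ResolutionOfSingularities-0549): brick
K3b-iii of PROGRAMME-clean-dim2 (Giraud's normal form over an ARBITRARY ground field). Helper file
(`--supports`), OURS; nothing here is a statement of Hironaka's manuscript.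

Giraud (Bull. SMF 111 (1983), Déf. 1.2) attaches to a function `f` on a regular scheme `X` of
characteristic `p` the closed set `E(f)` of points where `df ∈ 𝔪_x Ω¹_X` — for him `Ω¹_X` is locally
free OF FINITE RANK (`X` `F`-finite). Over an arbitrary ground field the tree reads `E(f)` without
`Ω¹` (`forall_derivation_apply_mem_iff_exists_sub_pow_mem_sq`): `x ∈ E(f)` iff every derivation of
`𝒪_{X,x}` maps `f` into `𝔪_x` iff `f ∈ 𝒪_{X,x}^p + 𝔪_x²`. This file computes `E(f)` IN COORDINATES
on an affine piece `Spec B` whose module of absolute differentials `Ω[B⁄ℤ]` is FREE (of any rank;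
such pieces cover the regular locus of every `k`-scheme of finite type, ANY field `k` of
characteristic `p`: `exists_free_kaehler_localization_away`): at a prime `𝔮`, with `B_𝔮` ANY
localisation of `B` at `𝔮`,

* `forall_derivation_apply_mem_iff_forall_repr_mem` — every derivation of `B_𝔮` maps `f` into
  `𝔮B_𝔮` iff all coordinates `b.repr (df) i` of `df` in a basis `b` of `Ω[B⁄ℤ]` lie in `𝔮`;
* `isClosed_setOf_forall_repr_mem` — the set of such `𝔮` is the zero locus of the coordinates,
  closed in `Spec B` (Giraud 2.2 (3): "`Sing(X, ω)` est un fermé", without finite rank).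

Proof. If all coordinates lie in `𝔮`, a derivation `D` of `B_𝔮` restricted to `B` factors through
`Ω[B⁄ℤ]`, so `D f = Σ cᵢ · (…) ∈ 𝔮B_𝔮`. If `cᵢ ∉ 𝔮`, the coordinate derivation `b.coord i ∘ d`
(value `cᵢ` on `f`) extends to `B_𝔮` (Stacks 07PE, `exists_derivation_extend_of_isLocalizedModule`),
where `cᵢ` is a unit.

## References
* J. Giraud, *Forme normale d'une fonction sur une surface de caractéristique positive*, Bull. Soc.
  Math. France 111 (1983), Déf. 1.2 and 2.2 (3). [Giraud1983]
* The Stacks Project, Tag 07PE. [StacksProject]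
-/

noncomputable section

set_option linter.dupNamespace false -- mandated namespace of this single-conjunct summit

open KaehlerDifferential Module IsLocalRing
open Literature.AlgebraicGeometry.Resolution

namespace Summit.ResolutionOfSingularities.ResolutionOfSingularities.Theorems.RadicialJung.CleanModels

universe u v w

/-- **`E(f)` in coordinates.** For `B` with `Ω[B⁄ℤ]` free on a basis `b`, `f ∈ B`, a prime `𝔮` and
ANY localisation `B_𝔮` of `B` at `𝔮`: every derivation of `B_𝔮` maps `f` into the maximal ideal iff
all coordinates `b.repr (df) i` lie in `𝔮`. [cite: Giraud1983, Déf. 1.2]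
[cite: StacksProject, Tag 07PE] -/
theorem forall_derivation_apply_mem_iff_forall_repr_mem {B : Type u} [CommRing B] {ι : Type v}
    (b : Basis ι B Ω[B⁄ℤ]) (f : B) (Q : Ideal B) [Q.IsPrime] (Bq : Type w) [CommRing Bq]
    [Algebra B Bq] [IsLocalization.AtPrime Bq Q] [IsLocalRing Bq] :
    (∀ D : Derivation ℤ Bq Bq, D (algebraMap B Bq f) ∈ maximalIdeal Bq) ↔
      ∀ i, b.repr (D ℤ B f) i ∈ Q := by
  classical
  constructor
  · -- a coordinate outside `𝔮` gives a derivation of `B_𝔮` with unit value on `f`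
    intro h i
    by_contra hi
    let δ : Derivation ℤ B B := (b.coord i).compDer (D ℤ B)
    have hδ : δ f = b.repr (D ℤ B f) i := rfl
    obtain ⟨δ', hδ'⟩ := exists_derivation_extend_of_isLocalizedModule Q.primeCompl Bq
      (Algebra.linearMap B Bq) δ
    have hmem := h δ'
    rw [hδ', Algebra.linearMap_apply, hδ,
      IsLocalization.AtPrime.to_map_mem_maximal_iff Bq Q] at hmem
    exact hi hmem
  · -- all coordinates in `𝔮`: every derivation of `B_𝔮` kills `f` modulo `𝔮`
    intro h D'
    let δ : Derivation ℤ B Bq := D'.compAlgebraMap B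
    have hδf : D' (algebraMap B Bq f) = δ.liftKaehlerDifferential (D ℤ B f) := by
      rw [Derivation.liftKaehlerDifferential_comp_D]
      rfl
    rw [hδf, ← b.linearCombination_repr (D ℤ B f), Finsupp.apply_linearCombination,
      Finsupp.linearCombination_apply]
    refine Submodule.sum_mem _ fun i _ => ?_
    simp only [Function.comp_apply, Algebra.smul_def]
    exact Ideal.mul_mem_right _ _
      ((IsLocalization.AtPrime.to_map_mem_maximal_iff Bq Q _).mpr (h i))

/-- **The coordinate locus is closed**: `{𝔮 : ∀ i, b.repr (df) i ∈ 𝔮}` is the zero locus of the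
coordinates of `df`, a closed subset of `Spec B`. [cite: Giraud1983, 2.2 (3)] -/
theorem isClosed_setOf_forall_repr_mem {B : Type u} [CommRing B] {ι : Type v}
    (b : Basis ι B Ω[B⁄ℤ]) (f : B) :
    IsClosed {Q : PrimeSpectrum B | ∀ i, b.repr (D ℤ B f) i ∈ Q.asIdeal} := by
  have : {Q : PrimeSpectrum B | ∀ i, b.repr (D ℤ B f) i ∈ Q.asIdeal} =
      PrimeSpectrum.zeroLocus (Set.range fun i => b.repr (D ℤ B f) i) := by
    ext Q
    simp only [Set.mem_setOf_eq, PrimeSpectrum.mem_zeroLocus, Set.range_subset_iff,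
      SetLike.mem_coe]
  rw [this]
  exact PrimeSpectrum.isClosed_zeroLocus _

end Summit.ResolutionOfSingularities.ResolutionOfSingularities.Theorems.RadicialJung.CleanModels

end
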